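import Literature.Topology.Algebra.ProfiniteAutCongruence
import Mathlib.Algebra.Group.Action.End
import Mathlib.Algebra.Group.Subgroup.Actions
import HarnessLib

/-!
# The congruence topology, V: `Aut(G)` acts continuously on `G`

Dixon–du Sautoy–Mann–Segal, *Analytic pro-`p` groups* (2nd ed., 1999), §5.2 (congruence topology,
`Γ(N) = {γ | [G, γ] ⊆ N}`) and Thm. 5.3 [cite: DixonEtAl1999, §5.2 Thm 5.3].  For a topologically
finitely generated profinite group `G`, the tautological action of `Aut_top(G)` — with the congruence
topology of `ProfiniteAutCongruence.lean` (`CongrAut G`) — on `G` is JOINTLY CONTINUOUS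
(`CongrAut.continuousSMul`): if `γ ≡ γ₀ (mod Γ(charCore G n))` and `g ≡ g₀ (mod charCore G n)` then
`γ(g) ≡ γ₀(g₀) (mod charCore G n)`, and the cosets of the `charCore G n` form a basis of the topology of
`G`.  This is the continuity needed to form topological semi-direct products `G ⋊ H` along continuous
`H → Aut_top(G)` (e.g. the arithmetic tempered groups of [SemiAnbd] §5).  Also: the action as a
`MulDistribMulAction (CongrAut G) G` (`γ • g = γ g`), `CongrAut.mk_smul` (levels compute the action
modulo `charCore G n`), `CongrAut.continuous_smul_left` (each `γ` acts by a homeomorphism — no finite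
generation needed).  Mathlib-level; nothing disputed is involved.
-/

namespace Literature.Topology.Algebra

open _root_.Topology Literature.AnabelianGeometry.AbsoluteAnabelian
open Literature.AnabelianGeometry.EtaleTheta (contMulAut mem_contMulAut)

universe u

variable (G : Type u) [Group G] [TopologicalSpace G] [IsTopologicalGroup G]

/-- The tautological action of `Aut_top(G)` (congruence topology) on `G`: `γ • g = γ(g)` (inherited from
Mathlib's `MulAut.applyMulDistribMulAction` through the subgroup `contMulAut G`).
[cite: DixonEtAl1999, §5.2 Thm 5.3] -/
instance CongrAut.instMulDistribMulAction : MulDistribMulAction (CongrAut G) G :=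
  inferInstanceAs (MulDistribMulAction (contMulAut G) G)

variable {G}

omit [IsTopologicalGroup G] in
/-- `γ • g = γ(g)`. [cite: DixonEtAl1999, §5.2 Thm 5.3] -/
theorem CongrAut.smul_def (γ : CongrAut G) (g : G) :
    γ • g = ((CongrAut.equivContMulAut G γ : contMulAut G) : MulAut G) g := rfl

omit [IsTopologicalGroup G] in
/-- Each `γ ∈ Aut_top(G)` acts by a continuous map (indeed a homeomorphism).
[cite: DixonEtAl1999, §5.2 Thm 5.3] -/
theorem CongrAut.continuous_smul_left (γ : CongrAut G) : Continuous fun g : G => γ • g :=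
  ((mem_contMulAut G).mp (CongrAut.equivContMulAut G γ : contMulAut G).2).1

/-- **Levels compute the action modulo `charCore G n`**:
`γ(g) mod charCore G n = (levelMap γ n)(g mod charCore G n)`. [cite: DixonEtAl1999, §5.2 Thm 5.3] -/
theorem CongrAut.mk_smul (γ : CongrAut G) (g : G) (n : ℕ) :
    ((γ • g : G) : G ⧸ charCore G n) =
      LevelAut.equivMulAut n (CongrAut.levelMap G γ n) (g : G ⧸ charCore G n) :=
  (levelHom_mk G n (CongrAut.equivContMulAut G γ) g).symm

omit [IsTopologicalGroup G] in
/-- `γ • g ∈ charCore G n ↔ g ∈ charCore G n` (the cores are characteristic).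
[cite: DixonEtAl1999, §1.1 Prop 1.6] -/
theorem CongrAut.smul_mem_charCore_iff (γ : CongrAut G) (g : G) (n : ℕ) :
    γ • g ∈ charCore G n ↔ g ∈ charCore G n :=
  apply_mem_charCore_iff ((mem_contMulAut G).mp (CongrAut.equivContMulAut G γ : contMulAut G).2).1
    ((mem_contMulAut G).mp (CongrAut.equivContMulAut G γ : contMulAut G).2).2 g

/-- **Congruence**: if `γ, γ₀` have the same `n`-th level and `g ≡ g₀ (mod charCore G n)` then
`γ(g) ≡ γ₀(g₀) (mod charCore G n)`. [cite: DixonEtAl1999, §5.2 Thm 5.3] -/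
theorem CongrAut.mk_smul_eq_of_level_eq {γ γ₀ : CongrAut G} {g g₀ : G} {n : ℕ}
    (hγ : CongrAut.levelMap G γ n = CongrAut.levelMap G γ₀ n)
    (hg : (g : G ⧸ charCore G n) = (g₀ : G ⧸ charCore G n)) :
    ((γ • g : G) : G ⧸ charCore G n) = ((γ₀ • g₀ : G) : G ⧸ charCore G n) := by
  rw [CongrAut.mk_smul, CongrAut.mk_smul, hγ, hg]

/-- **`Aut_top(G)` acts continuously on `G`** (`G` topologically finitely generated profinite,
congruence topology): the action map `(γ, g) ↦ γ(g)` is jointly continuous.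
[cite: DixonEtAl1999, §5.2 Thm 5.3] -/
theorem CongrAut.continuousSMul [CompactSpace G] [TotallyDisconnectedSpace G]
    (hG : IsTopologicallyFinitelyGenerated G) : ContinuousSMul (CongrAut G) G := by
  refine ⟨continuous_iff_continuousAt.mpr fun p => ?_⟩
  obtain ⟨γ₀, g₀⟩ := p
  rw [ContinuousAt]
  intro W hW
  -- an open `W' ⊆ W` around `γ₀ g₀`, and a core `charCore G n` with `(γ₀ g₀) · charCore G n ⊆ W'`
  obtain ⟨W', hW'W, hW'o, hx⟩ := mem_nhds_iff.mp hW
  have h1 : (1 : G) ∈ (fun y => (γ₀ • g₀) * y) ⁻¹' W' := by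
    simp only [Set.mem_preimage, mul_one]; exact hx
  obtain ⟨n, -, hn⟩ := exists_charCore_subset (G := G) (hW'o.preimage (by fun_prop)) h1
  -- the neighbourhoods: same `n`-th level as `γ₀`; same class as `g₀` modulo `charCore G n`
  let A : Set (CongrAut G) := (fun γ => CongrAut.levelMap G γ n) ⁻¹' {CongrAut.levelMap G γ₀ n}
  let B : Set G := (fun g => g₀⁻¹ * g) ⁻¹' (charCore G n : Set G)
  have hA : A ∈ 𝓝 γ₀ := by
    refine IsOpen.mem_nhds ?_ rfl
    exact (isOpen_discrete _).preimage ((continuous_apply n).comp (CongrAut.continuous_levelMap G))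
  have hB : B ∈ 𝓝 g₀ := by
    refine IsOpen.mem_nhds ((isOpen_charCore hG n).preimage (by fun_prop)) ?_
    change g₀⁻¹ * g₀ ∈ charCore G n
    rw [inv_mul_cancel]; exact (charCore G n).one_mem
  refine Filter.mem_map.mpr (Filter.mem_of_superset (prod_mem_nhds hA hB) ?_)
  rintro ⟨γ, g⟩ ⟨hγ, hg⟩
  change CongrAut.levelMap G γ n = CongrAut.levelMap G γ₀ n at hγ
  change g₀⁻¹ * g ∈ charCore G n at hg
  have hgq : (g : G ⧸ charCore G n) = (g₀ : G ⧸ charCore G n) := by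
    rw [eq_comm, QuotientGroup.eq]; exact hg
  have hq := CongrAut.mk_smul_eq_of_level_eq hγ hgq
  rw [eq_comm, QuotientGroup.eq] at hq
  -- `(γ₀ • g₀)⁻¹ * (γ • g) ∈ charCore G n`, so `γ • g ∈ (γ₀ • g₀) · charCore G n ⊆ W' ⊆ W`
  have hmem : γ • g ∈ W' := by
    have := hn hq
    simpa [Set.mem_preimage, mul_inv_cancel_left] using this
  exact hW'W hmem

end Literature.Topology.Algebra
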